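import Summits.QuantumFields.YangMills.Theorems.UnitScaleTiltFluctuationComparisonRegPrAnsatzTStub
import Summits.QuantumFields.YangMills.Theorems.UnitScaleTiltFluctuationComparisonRegPrOneStepSubmersion

/-!
# Route `UnitScaleTilt` — crux `FluctuationComparisonRegPrL` (stmt-QuantumFields-19935, ex 19201): **`posOnSmall` UNCONDITIONALLY**

The original registered statement `stub_posOnSmall` of the crux line (birth 04793f26c2da46ec on the aside item
stmt-QuantumFields-19201; carried verbatim as the lemma `posOnSmall` of the registered 19935 skeleton v5h a621e9fb492a9f9b) —
a.e. positivity of BOTH restricted height densities (run `K` and run `K + 1`, read at the common height `⌊K/m⌋`) on the printed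
small-field window `{PlaqSmall (θBal F.L γ b₀ p₀ ⌊K/m⌋)}` — is now a THEOREM with no hypothesis: the one-step small lift
`ApproxLift.AnsatzT.stub_oneStepSmallLift` (STUB 1, landed p490827: certified face table at `L = 3`, ANSATZ S at `L = 5`, ANSATZ T at
odd `L ≥ 7`) composed with `OneStepSubmersion.posOnSmall_of_oneStepSmallLift` (p446430: one-step submersion (O) ∧ (N) of the (0.4)/EML
averaging on small `SU(2)` fields ⇒ «Lemma B» below a radius ⇒ tower ⇒ positivity).  With it the v5h skeleton's `posOnSmall` and STUB 1
are imports (sorries 4 → 3).  Fleet seat ym-ust-19201-p1 gen 3; `--supports stmt-QuantumFields-19935`.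
-/

noncomputable section

namespace Summit.QuantumFields.YangMills.Theorems.PosOnSmall

open MeasureTheory
open Literature.MathematicalPhysics.QuantumFieldTheory.Balaban1983to89
open Literature.MathematicalPhysics.QuantumFieldTheory.Balaban1983to89.T4Continuum
open Literature.MathematicalPhysics.QuantumFieldTheory.Balaban1983to89.T3ContinuumYM3Torus
open Literature.MathematicalPhysics.QuantumFieldTheory.Balaban1983to89.T3UnitLawDensityEML (ℰp)
open Literature.MathematicalPhysics.QuantumFieldTheory.Balaban1983to89.T3UnitScaleTilt
open Literature.MathematicalPhysics.QuantumFieldTheory.Balaban1983to89.T3TiltDescent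
open Literature.MathematicalPhysics.QuantumFieldTheory.Balaban1983to89.T3SmallLiftHistory

/-- **`posOnSmall` (the registered statement of the old `stub_posOnSmall`, VERBATIM), PROVED WITHOUT HYPOTHESES**: for every block size
`L`, every `m > 0` and every threshold profile `(b₀, p₀)` with `0 < b₀`, `2 < p₀` there is `γ₁ > 0` such that for every `d = 3` family
`F` of block size `L`, every coupling `0 < γ ≤ γ₁` and every run `K`, for `fieldMeasure`-a.e. unit-scale field `V` in the small-field
window `PlaqSmall (θBal F.L γ b₀ p₀ ⌊K/m⌋)` both restricted height densities — of run `K` and of run `K + 1`, on the good-history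
events `histGood … K ⌊K/m⌋` / `histGood … (K+1) ⌊K/m⌋` — are strictly positive at `V`.  Proof: `posOnSmall_of_oneStepSmallLift`
(p446430) applied to the landed STUB 1 `ApproxLift.AnsatzT.stub_oneStepSmallLift` (p490827).
[cite: Balaban1985UV3, (2) p.256, (7) p.257 and (41) p.266; Balaban1987RG1, (0.4)/(0.18) p.253] -/
theorem posOnSmall :
    ∀ (L m : ℕ), 0 < m → ∀ (b₀ p₀ : ℝ), 0 < b₀ → 2 < p₀ → ∃ γ₁ : ℝ, 0 < γ₁ ∧
      ∀ (F : T3Family) (γ : ℝ), F.L = L → 0 < γ → γ ≤ γ₁ →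
        ∀ K, ∀ᵐ V ∂fieldMeasure (F.P (K / m)) 0 (Matrix.specialUnitaryGroup (Fin 2) ℂ),
          PlaqSmall (θBal F.L γ b₀ p₀ (K / m)) V →
            0 < heightDensity F γ (Nat.div_le_self K m) (histGood F ℰp (θBal F.L γ b₀ p₀) K (K / m)) V ∧
            0 < heightDensity F γ ((Nat.div_le_self K m).trans (Nat.le_succ K))
                  (histGood F ℰp (θBal F.L γ b₀ p₀) (K + 1) (K / m)) V :=
  Summit.QuantumFields.YangMills.Theorems.OneStepSubmersion.posOnSmall_of_oneStepSmallLift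
    Summit.QuantumFields.YangMills.Theorems.ApproxLift.AnsatzT.stub_oneStepSmallLift

end Summit.QuantumFields.YangMills.Theorems.PosOnSmall

end
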